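import Literature.NumberTheory.Automorphic.CDTTheorem722
import Literature.NumberTheory.Automorphic.KisinTaylorWilesHypothesisFive
import Literature.NumberTheory.Automorphic.HeckeAlgebraOfTypeSigma
import Literature.NumberTheory.EllipticCurves.MultiplicativeReductionDecompLineProofs
import Literature.NumberTheory.EllipticCurves.FrobeniusTateModuleProofs
import Literature.NumberTheory.EllipticCurves.FramedTateGaloisRep
import Literature.NumberTheory.EllipticCurves.RootNumberProofs
import Literature.NumberTheory.EllipticCurves.RootNumberTwistProofs
import Literature.NumberTheory.EllipticCurves.SzpiroLocalDataProofs
import Literature.NumberTheory.DiophantineGeometry.ConductorMultiplicativeProofs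
import Literature.NumberTheory.DiophantineGeometry.PastenValuationProductsProofs
import Literature.NumberTheory.DiophantineGeometry.GeneralizedFermatTwoPowerCoefficientFreySaitoProofs
import Literature.NumberTheory.GaloisRepresentations.OrdinaryGaloisRep
import HarnessLib

/-!
# Stub-ideation companion (k = 3, GEN 6 — family "probe the extremes") for `stub_liftFive`

Crux `FreyModularity` (stmt-ABC-11340), line `Sketch` (sha 21576c53).  Elaboration-checked statements
for `STUB-IDEAS-stub_liftFive-3.md` (gen 6).  Gens 3–5 of this slot (`…_3g3/_3g4/_3g5.lean`, all rc 0)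
are NOT repeated: gen 4 pinned the consumed instance at `5` (case B ⇒ `5 ∣ abc` ⇒ `W` multiplicative
at `5`: `hasMultiplicativeReductionAtPrime_five_of_caseB`), gen 5 typed the curve-to-curve corner
engine `LiftFiveWilesCorner` (E5) and PROVED the transfer lemmas T1/T1′/T3/T3F/T4/T5 and the case-B
consumer `isModularGaloisRepTate_five_of_corner`.

GEN 6 pushes the extremal pinning down to the LOCAL GALOIS DATA of `ρ_{W,5}` and records that every
local hypothesis of Wiles 1995, Thm. 0.2 case (i) (ordinary) at `p = 5` is, for the pinned instance,
a THEOREM OF THE TREE or a short assembly of tree theorems (the tree now has Tate's uniformisation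
with its Galois action: `TateCurve.Silverman1994_thmV53_corV54_tateUniformisation_holds`,
`TateCurve.exists_basis_galoisRepTorsion_tateCurve`):

* §1 the ports — P1 residual toric line at `v ∣ 5` (PROVED, tree), P3 `det ρ_{W,5} = χ₅` (PROVED,
  tree), P5 Kisin's Taylor–Wiles clause at `5` over `ℚ` (PROVED, tree); and the statement SHAPES with
  `sorry` stubs of P2 (the multiplicative-ordinary filtration of `V₅W` at `v ∣ 5`, typed as the exact
  sibling of the tree's good-ordinary named fact `ellipticOrdinaryReduction_tateModule_filtration`),
  P2′ (its Skinner–Wiles reading `IsOrdinaryOfWeightAt 5 (W.framedTateGaloisRep 5) v 2 1`) and P4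
  (type A off `5`: inertia unipotent on `T₅W` at multiplicative `v ∤ 5`);
* §2 the engine in Galois-local form, E6 `WilesOrdinaryLiftFive` (= Wiles Thm. 0.2 (i) + Taylor–Wiles
  at `p = 5`, `k = 2`, `𝒪 = ℤ₅`, `ρ = T₅W`; residual modularity still supplied by a modular CURVE
  `W'`, so no Ash–Stevens / weight port is hidden), the place-level corner E6c `LiftFiveLocalCorner`,
  and the PROVED calibrations  E6 + P2′ + P4 ⇒ E6c,  E6c + S4b ⇒ E5 (gen 5),  `stub_liftFive` ⇒ E6c,
  `CDT_theorem_7_2_2` ⇒ E6 — so E6 ≤ E6c ≤ {registered stub, accepted debt} and E6c feeds gen 5's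
  consumer unchanged;
* §3 the typed GAP in the tree's `T_Σ`: `modularLiftsOfTypeSigma` only admits members of level
  `M` with `¬ p ∣ M`, while EVERY case-B instance has `5 ∥ N_W` (documentation-only Prop).

Imports are Literature-only (`Summits.ABC.ABC.…DefiniteXi…` is `remote:stale:…:unbuilt` on the farm
snapshot, re-probed 2026-08-31).
-/

noncomputable section

open scoped MatrixGroups NumberField
open Literature.NumberTheory.EllipticCurves
open Literature.NumberTheory.EllipticCurves.ModularForms
open Literature.NumberTheory.DiophantineGeometry
open Literature.NumberTheory.Automorphic
open Literature.NumberTheory.Automorphic.BCDT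
open Literature.NumberTheory.GaloisRepresentations
open WeierstrassCurve IsDedekindDomain Rat.HeightOneSpectrum Field

namespace Summit.ABC.ABC.Cruxes.FreyModularity.StubIdeas.LiftFive3g6

instance instFactPrimeFive : Fact (Nat.Prime 5) := ⟨by norm_num⟩

/-! ## §0 The registered stub (verbatim) and gen 5's corner engine E5 (by value) -/

/-- The registered signature of `stub_liftFive` (VERBATIM). [cite: Diamond1996, Thm. 5.3] -/
def LiftFive : Prop :=
  ∀ (W : WeierstrassCurve ℚ) [W.IsElliptic] (ρ : ModPGaloisRep ℚ (ZMod 5) 2),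
    W.IsTorsionGaloisRep 5 ρ → ρ.IsAbsIrreducibleOverSqrt 5 → ¬ 25 ∣ W.conductorNorm ℤ →
    ρ.IsModular → W.IsModularGaloisRepTate 5

/-- Gen 5's corner engine **E5** (`STUB_IDEAS_stub_liftFive_3g5.lean`, by value): both curves
semistable with `5 ∣ N`. [cite: Wiles1995Annals, Thm. 0.2 (i) and Ch. 3] -/
def LiftFiveWilesCorner : Prop :=
  ∀ (W W' : WeierstrassCurve ℚ) [W.IsElliptic] [W'.IsElliptic] [NeZero (W'.conductorNorm ℤ)]
    (ρ : ModPGaloisRep ℚ (ZMod 5) 2),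
    W.IsSemistable ℤ → W'.IsSemistable ℤ → 5 ∣ W.conductorNorm ℤ → 5 ∣ W'.conductorNorm ℤ →
    W.IsTorsionGaloisRep 5 ρ → W'.IsTorsionGaloisRep 5 ρ → FramedRep.IsIrreducible ρ →
    BCDT.IsModular W' → W.IsModularGaloisRepTate 5

/-- The landed S4b in hypothesis shape (`Summit.ABC.ABC.Theorems.stub_absIrrSqrtFive`, PROVED in the
tree; taken as a hypothesis only because `Summits.…` modules are unbuilt on the farm snapshot).
[cite: ConradDiamondTaylor1999, Lemma 7.2.3] -/
def AbsIrrSqrtFiveShape : Prop :=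
  ∀ (W : WeierstrassCurve ℚ) [W.IsElliptic], ¬ 25 ∣ W.conductorNorm ℤ →
    ∀ ρ : ModPGaloisRep ℚ (ZMod 5) 2, W.IsTorsionGaloisRep 5 ρ →
      FramedRep.IsIrreducible ρ → ρ.IsAbsIrreducibleOverSqrt 5

/-! ## §1 The ports: Wiles (i)'s local hypotheses for the pinned instance -/

/-- **P1 (PROVED, tree).** At a multiplicative `v ∣ 5`, `W[5]` has a `Γ_{ℚ₅}`-stable line of order
`5` with inertia trivial on the quotient — the residual ORDINARY + `D₅`-DISTINGUISHED hypothesis of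
Wiles Thm. 0.2 (i) (inertia acts on the line by `det = χ̄₅`, of order `4 ≠ 1` on `I₅`).  Literally
`exists_decompStableLine_geomTorsion_of_hasMultiplicativeReductionAt_rat` at `p = 5`.
[cite: SerreInventiones1972, §1.12, Prop. 13 and Cor.] -/
theorem residualToricLine_five (W : WeierstrassCurve ℚ) [W.IsElliptic]
    {v : HeightOneSpectrum (𝓞 ℚ)} (hv : ((5 : ℕ) : 𝓞 ℚ) ∈ v.asIdeal)
    (hmult : W.HasMultiplicativeReductionAt v) :
    ∃ Λ : AddSubgroup (geomPoints W), Λ ≤ geomTorsion W 5 ∧ Nat.card Λ = 5 ∧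
      (∀ (σ : absoluteGaloisGroup (v.adicCompletion ℚ)), ∀ x ∈ Λ,
        absGaloisRestrict ℚ (v.adicCompletion ℚ) σ • x ∈ Λ) ∧
      (∀ τ ∈ absInertia (v.adicCompletion ℚ), ∀ P ∈ geomTorsion W 5,
        absGaloisRestrict ℚ (v.adicCompletion ℚ) τ • P - P ∈ Λ) :=
  W.exists_decompStableLine_geomTorsion_of_hasMultiplicativeReductionAt_rat (by norm_num) hv hmult

/-- **P2 shape — the multiplicative-ordinary filtration of `V_pE` at `v ∣ p`** (Tate:
`0 → ℚ_p(1) → V_pE_q → ℚ_p → 0` over the unramified quadratic extension trivialising `γ(E/K_v)`),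
typed as the EXACT sibling of the tree's good-ordinary named fact
`ellipticOrdinaryReduction_tateModule_filtration` (hypothesis `HasGoodReductionAt v ∧ p ∤ a_v`
replaced by `HasMultiplicativeReductionAt v`): a `Γ_{K_v}`-stable `ℚ_p`-line `L ⊂ V_pE` on which the
inertia group acts through `χ_p` and such that it acts trivially on `V_pE/L`.  Assembly inputs now in
the tree: `TateCurve.Silverman1994_thmV53_corV54_tateUniformisation_holds` (twisted-equivariant
`Ψ : K̄_v^× → E(K̄_v)`, kernel `q^ℤ`), `TateCurve.exists_basis_galoisRepTorsion_tateCurve` (triangular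
action on `E_q[N]`), `TateCurve.toAlgEquiv_eq_of_mem_inertia_of_sq_eq_gamma` (the twist is unramified).
[cite: SilvermanATAEC1994, V §5 Thm. 5.3, Cor. 5.4; V §6 Prop. 6.1] [cite: SerreInventiones1972, §1.12 and (3.1)] -/
def MultiplicativeOrdinaryFiltrationShape : Prop :=
  ∀ {K : Type} [Field K] [NumberField K] (W : WeierstrassCurve K) [W.IsElliptic]
    (p : ℕ) [Fact p.Prime] (v : HeightOneSpectrum (𝓞 K)),
    (p : 𝓞 K) ∈ v.asIdeal → W.HasMultiplicativeReductionAt v →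
    ∃ L : Submodule ℚ_[p] (W.rationalTateModule p),
      Module.finrank ℚ_[p] L = 1 ∧
      (∀ (τ : absoluteGaloisGroup (v.adicCompletion K)), ∀ x ∈ L,
        W.rationalGaloisRepTate p (absGaloisRestrict K (v.adicCompletion K) τ) x ∈ L) ∧
      (∀ τ ∈ absInertia (v.adicCompletion K), ∀ x ∈ L,
        W.rationalGaloisRepTate p (absGaloisRestrict K (v.adicCompletion K) τ) x =
          (((GaloisRep.cyclotomicCharacter (v.adicCompletion K) p τ : ℤ_[p]ˣ) : ℤ_[p]) : ℚ_[p]) • x) ∧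
      (∀ τ ∈ absInertia (v.adicCompletion K), ∀ x : W.rationalTateModule p,
        W.rationalGaloisRepTate p (absGaloisRestrict K (v.adicCompletion K) τ) x - x ∈ L)

/-- P2 as a stub (M: Tate uniformisation level by level + passage to `T_p`). [cite: SilvermanATAEC1994, V §5 Thm. 5.3] -/
theorem stub_multiplicativeOrdinaryFiltration : MultiplicativeOrdinaryFiltrationShape := by
  sorry

/-- **P2′ shape — the Skinner–Wiles reading** consumed by an `R = T` port: `ρ_{W,5}|_{Γ_{ℚ₅}}` is
ORDINARY OF WEIGHT `2` with inertial exponent `1` (tree `FramedGaloisRep.IsOrdinaryOfWeightAt`: a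
frame in which `Γ_{ℚ₅}` is upper triangular with diagonal `(χ₅, 1)` on `I₅`); from P2 by choosing a
`ℚ̄₅`-basis adapted to `L ⊗ ℚ̄₅` (the framed Tate representation is `T₅W ⊗ ℚ̄₅` in the tree's basis).
[cite: SkinnerWiles1999, §1 Theorem (ii)] [cite: SilvermanATAEC1994, V §5 Thm. 5.3] -/
def OrdinaryWeightTwoAtFiveShape : Prop :=
  ∀ (W : WeierstrassCurve ℚ) [W.IsElliptic] (v : HeightOneSpectrum (𝓞 ℚ)),
    ((5 : ℕ) : 𝓞 ℚ) ∈ v.asIdeal → W.HasMultiplicativeReductionAt v →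
    FramedGaloisRep.IsOrdinaryOfWeightAt 5 (W.framedTateGaloisRep 5) v 2 1

/-- P2′ as a stub (S/M glue over P2). [cite: SkinnerWiles1999, §1 Theorem (ii)] -/
theorem stub_ordinaryWeightTwoAtFive : OrdinaryWeightTwoAtFiveShape := by
  sorry

/-- **P3 (PROVED, tree).** `det ρ_{W,5} = χ₅` on `T₅W` — Wiles's "`det ρ = χ^{k-1} ε`" with `k = 2`,
`ε = 1`. [cite: SilvermanAEC2009, Prop. III.8.1 and III.8.3] -/
theorem det_tate_five (W : WeierstrassCurve ℚ) [W.IsElliptic] (σ : absoluteGaloisGroup ℚ) :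
    LinearMap.det (W.galoisRepTate 5 σ : W.tateModule 5 →ₗ[ℤ_[5]] W.tateModule 5) =
      ((GaloisRep.cyclotomicCharacter ℚ 5 σ : ℤ_[5]ˣ) : ℤ_[5]) :=
  det_galoisRepTate_eq_cyclotomicCharacter_holds W 5 (by norm_num) σ

/-- **P4 shape — TYPE A off `5`.**  At a multiplicative `v ∤ 5` every inertia element acts
UNIPOTENTLY on `T₅W`, `(σ - 1)² = 0`: the limit over `n` of the tree's level-`5ⁿ` statement
`exists_tateBasis_localPoints_of_hasMultiplicativeReductionAt` (`τ P₁ = P₁`, `τ P₂ - P₂ ∈ ⟨P₁⟩` for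
every inertia `τ`), or of `TateCurve.exists_basis_galoisRepTorsion_tateCurve` through the uniformisation.
[cite: SilvermanATAEC1994, V.4–V.5 and Exercise 5.13(b)] [cite: SerreAbelianLadic1968, Ch. IV, A.1.2] -/
def TypeAOffFiveShape : Prop :=
  ∀ (W : WeierstrassCurve ℚ) [W.IsElliptic] (v : HeightOneSpectrum (𝓞 ℚ)),
    ((5 : ℕ) : 𝓞 ℚ) ∉ v.asIdeal → W.HasMultiplicativeReductionAt v →
    ∀ 𝔓 ∈ v.primesAbove, ∀ σ ∈ 𝔓.inertia (absoluteGaloisGroup ℚ),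
      (W.galoisRepTate 5 σ - 1) * (W.galoisRepTate 5 σ - 1) = 0

/-- P4 as a stub (S/M: inverse limit of the level-wise basis). [cite: SilvermanATAEC1994, V.4–V.5] -/
theorem stub_typeAOffFive : TypeAOffFiveShape := by
  sorry

/-- **P5 (PROVED, tree).** Kisin's extra Taylor–Wiles clause at `p = 5` holds for `W[5]` over `ℚ`;
together with `IsAbsIrreducibleOverSqrt 5` (Kisin (3.2.3)(2) for `F = ℚ`: absolute irreducibility over
`ℚ(√5) ⊂ ℚ(ζ₅)`) this is the residual-image hypothesis of every printed `R = T` theorem at `5`.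
[cite: KisinModuli2009, (3.2.3)(2)–(3)] [cite: FreitasLeHungSiksek2015, §2 (proof of Thm. 2, p = 5)] -/
theorem twHypothesis_five (W : WeierstrassCurve ℚ) [W.IsElliptic] {ρ : ModPGaloisRep ℚ (ZMod 5) 2}
    (hρ : W.IsTorsionGaloisRep 5 ρ) : Kisin2009.hypothesisFive ℚ ρ :=
  Kisin2009.hypothesisFive_of_isTotallyReal W hρ

/-! ## §2 The engine read locally: E6 (Galois-local), E6c (place-level corner), calibrations -/

/-- **E6 `WilesOrdinaryLiftFive`** — Wiles 1995 Thm. 0.2 case (i) + Taylor–Wiles, specialised to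
`p = 5`, weight `2`, `𝒪 = ℤ₅`, `ρ = T₅W`: if a framed model `ρ̄` of `W[5]` is absolutely irreducible
over `ℚ(√5)` and is `W'[5]` for a MODULAR curve `W'` (residual modularity of weight `2`), if
`ρ_{W,5}|_{Γ_{ℚ₅}}` is ordinary of weight `2` (P2′) and if inertia at every `v ∤ 5` acts unipotently on
`T₅W` (type A, P4 — so Wiles's proviso (b) on `q ≡ -1 (mod p)` is void: `ρ̄|_{D_q}` is reducible),
then `ρ_{W,5}` is modular.  `det = χ₅` is automatic (P3).  No flat / potentially Barsotti–Tate clause: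
by gen 4 the flat branch is never met by the consumer.
[cite: Wiles1995Annals, Thm. 0.2 (i), Thm. 2.17, Ch. 3] [cite: TaylorWiles1995, Thms. 1–2] -/
def WilesOrdinaryLiftFive : Prop :=
  ∀ (W W' : WeierstrassCurve ℚ) [W.IsElliptic] [W'.IsElliptic] [NeZero (W'.conductorNorm ℤ)]
    (ρ : ModPGaloisRep ℚ (ZMod 5) 2),
    W.IsTorsionGaloisRep 5 ρ → W'.IsTorsionGaloisRep 5 ρ → ρ.IsAbsIrreducibleOverSqrt 5 →
    BCDT.IsModular W' →
    (∀ v : HeightOneSpectrum (𝓞 ℚ), ((5 : ℕ) : 𝓞 ℚ) ∈ v.asIdeal →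
      FramedGaloisRep.IsOrdinaryOfWeightAt 5 (W.framedTateGaloisRep 5) v 2 1) →
    (∀ v : HeightOneSpectrum (𝓞 ℚ), ((5 : ℕ) : 𝓞 ℚ) ∉ v.asIdeal →
      ∀ 𝔓 ∈ v.primesAbove, ∀ σ ∈ 𝔓.inertia (absoluteGaloisGroup ℚ),
        (W.galoisRepTate 5 σ - 1) * (W.galoisRepTate 5 σ - 1) = 0) →
    W.IsModularGaloisRepTate 5

/-- **E6c `LiftFiveLocalCorner`** — the same with the local hypotheses read on the CURVE at the
places of `𝓞 ℚ`: multiplicative at `v ∣ 5`, good or multiplicative at `v ∤ 5`.  This is the interface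
gen 5's case-B consumer `isModularGaloisRepTate_five_of_corner` wants (via
`localData_of_isSemistable_of_hasMultiplicativeReductionAtPrime` below). [cite: Wiles1995Annals, Thm. 0.2 (i)] -/
def LiftFiveLocalCorner : Prop :=
  ∀ (W W' : WeierstrassCurve ℚ) [W.IsElliptic] [W'.IsElliptic] [NeZero (W'.conductorNorm ℤ)]
    (ρ : ModPGaloisRep ℚ (ZMod 5) 2),
    W.IsTorsionGaloisRep 5 ρ → W'.IsTorsionGaloisRep 5 ρ → ρ.IsAbsIrreducibleOverSqrt 5 →
    BCDT.IsModular W' →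
    (∀ v : HeightOneSpectrum (𝓞 ℚ), ((5 : ℕ) : 𝓞 ℚ) ∈ v.asIdeal →
      W.HasMultiplicativeReductionAt v) →
    (∀ v : HeightOneSpectrum (𝓞 ℚ), ((5 : ℕ) : 𝓞 ℚ) ∉ v.asIdeal →
      W.HasGoodReductionAt v ∨ W.HasMultiplicativeReductionAt v) →
    W.IsModularGaloisRepTate 5

/-- **E6 + P2′ + P4 ⇒ E6c (PROVED).**  At a good `v ∤ 5` inertia is trivial on `T₅W`
(`galoisRepTate_eq_one_of_mem_inertia`, Néron–Ogg–Shafarevich, easy direction), so type A holds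
there too. [folklore] -/
theorem liftFiveLocalCorner_of_wiles (hP2 : OrdinaryWeightTwoAtFiveShape) (hP4 : TypeAOffFiveShape)
    (hE6 : WilesOrdinaryLiftFive) : LiftFiveLocalCorner := by
  intro W W' _ _ _ ρ hρ hρ' hirr hW' h5 hoff
  refine hE6 W W' ρ hρ hρ' hirr hW' (fun v hv ↦ hP2 W v hv (h5 v hv)) ?_
  intro v hv 𝔓 h𝔓 σ hσ
  rcases hoff v hv with hgood | hmult
  · have h1 : W.galoisRepTate 5 σ = 1 :=
      W.galoisRepTate_eq_one_of_mem_inertia 5 hgood (by exact_mod_cast hv) h𝔓 hσ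
    rw [h1, sub_self, zero_mul]
  · exact hP4 W v hv hmult 𝔓 h𝔓 σ hσ

/-- **`CDT_theorem_7_2_2` ⇒ E6 (PROVED)** — E6 never costs more than the accepted debt behind the
in-place closer `stub_liftFive_of_CDT_theorem_7_2_2`: `ρ̄` is modular from the modular `W'`
(`IsModular.isModular_of_isTorsionGaloisRep''`), CDT 7.2.2 gives `IsModular W`, and (2) ⇒ (4) is the
tree's PROVED `IsModular.isModularGaloisRepTate`. [cite: ConradDiamondTaylor1999, Thm. 7.2.2] -/
theorem wilesOrdinaryLiftFive_of_CDT_theorem_7_2_2 (h : CDT_theorem_7_2_2) : WilesOrdinaryLiftFive := by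
  intro W W' _ _ _ ρ hρ hρ' hirr hW' _ _
  haveI : NeZero (W.conductorNorm ℤ) := ⟨(conductorNorm_pos_holds W).ne'⟩
  exact (h W ρ hρ hirr (hW'.isModular_of_isTorsionGaloisRep'' hρ')).isModularGaloisRepTate 5

/-- `p ∥ N` at a multiplicative prime (gen 5, re-proved: `f_p = 1`). [cite: SilvermanATAEC1994, Thm. IV.10.2(b)] -/
theorem dvd_and_not_sq_dvd_of_hasMultiplicativeReductionAtPrime (W : WeierstrassCurve ℚ)
    [W.IsElliptic] {p : ℕ} [hp : Fact p.Prime] (hm : W.HasMultiplicativeReductionAtPrime p) :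
    p ∣ W.conductorNorm ℤ ∧ ¬ p ^ 2 ∣ W.conductorNorm ℤ := by
  have hfac : (W.conductorNorm ℤ).factorization p = 1 := by
    rw [show p = ((⟨p, hp.out⟩ : Nat.Primes) : ℕ) from rfl, factorization_conductorNorm_primesEquiv_symm]
    exact (conductorExponent_eq_one_iff_holds _ W).mpr
      (((hasMultiplicativeReductionAtPrime_iff_hasMultiplicativeReductionAt_holds W) ⟨p, hp.out⟩).mp hm)
  have hN : W.conductorNorm ℤ ≠ 0 := (conductorNorm_pos_holds W).ne'
  refine ⟨?_, ?_⟩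
  · have h1 := (Nat.Prime.pow_dvd_iff_le_factorization hp.out hN (k := 1)).mpr (by omega)
    rwa [pow_one] at h1
  · rw [Nat.Prime.pow_dvd_iff_le_factorization hp.out hN]
    omega

/-- Bridge: prime-indexed multiplicative reduction ⇒ multiplicative at the place of `𝓞 ℚ` above `p`
(`hasMultiplicativeReductionAtPrime_iff_hasMultiplicativeReductionAt_ringOfIntegers`). [folklore] -/
theorem hasMultiplicativeReductionAt_of_atPrime (W : WeierstrassCurve ℚ) [W.IsElliptic] {p : ℕ}
    [hp : Fact p.Prime] (h : W.HasMultiplicativeReductionAtPrime p) (v : HeightOneSpectrum (𝓞 ℚ))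
    (hv : (p : 𝓞 ℚ) ∈ v.asIdeal) : W.HasMultiplicativeReductionAt v := by
  have hpe : ((primesEquiv v : Nat.Primes) : ℕ) = p := by
    rw [(natCast_mem_asIdeal_iff_eq_primesEquiv_symm v hp.out).mp hv, Equiv.apply_symm_apply]
  subst hpe
  exact (W.hasMultiplicativeReductionAtPrime_iff_hasMultiplicativeReductionAt_ringOfIntegers v).mp h

/-- Bridge, converse direction. [folklore] -/
theorem hasMultiplicativeReductionAtPrime_of_at (W : WeierstrassCurve ℚ) [W.IsElliptic] {p : ℕ}
    [hp : Fact p.Prime] (v : HeightOneSpectrum (𝓞 ℚ)) (hv : (p : 𝓞 ℚ) ∈ v.asIdeal)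
    (h : W.HasMultiplicativeReductionAt v) : W.HasMultiplicativeReductionAtPrime p := by
  have hpe : ((primesEquiv v : Nat.Primes) : ℕ) = p := by
    rw [(natCast_mem_asIdeal_iff_eq_primesEquiv_symm v hp.out).mp hv, Equiv.apply_symm_apply]
  subst hpe
  exact (W.hasMultiplicativeReductionAtPrime_iff_hasMultiplicativeReductionAt_ringOfIntegers v).mpr h

/-- **`stub_liftFive` ⇒ E6c (PROVED)** — E6c is WEAKER than the registered stub: `25 ∤ N_W` from
multiplicativity at `5` and `ρ̄` modular from `W'`. [folklore] -/
theorem liftFiveLocalCorner_of_liftFive (h : LiftFive) : LiftFiveLocalCorner := by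
  intro W W' _ _ _ ρ hρ hρ' hirr hW' h5 _
  set v₅ : HeightOneSpectrum (𝓞 ℚ) := (primesEquiv (R := 𝓞 ℚ)).symm ⟨5, Nat.prime_five⟩ with hv₅
  have hmem : ((5 : ℕ) : 𝓞 ℚ) ∈ v₅.asIdeal :=
    (natCast_mem_asIdeal_iff_eq_primesEquiv_symm v₅ Nat.prime_five).mpr hv₅
  have hP : W.HasMultiplicativeReductionAtPrime 5 :=
    hasMultiplicativeReductionAtPrime_of_at W v₅ hmem (h5 v₅ hmem)
  have h25 : ¬ 25 ∣ W.conductorNorm ℤ := by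
    have := (dvd_and_not_sq_dvd_of_hasMultiplicativeReductionAtPrime W hP).2
    norm_num at this
    exact this
  exact h W ρ hρ hirr h25 (hW'.isModular_of_isTorsionGaloisRep'' hρ')

/-- **The local data of a semistable curve multiplicative at `5` (PROVED)**: the transport from the
`ℤ`-indexed data the skeleton produces in case B (`IsSemistable ℤ`,
`HasMultiplicativeReductionAtPrime 5`) to the `𝓞 ℚ`-indexed hypotheses of E6c
(`isSemistable_ringOfIntegers_of_isSemistable_int`). [folklore] -/
theorem localData_of_isSemistable_of_hasMultiplicativeReductionAtPrime (W : WeierstrassCurve ℚ)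
    [W.IsElliptic] (hss : W.IsSemistable ℤ) (h5 : W.HasMultiplicativeReductionAtPrime 5) :
    (∀ v : HeightOneSpectrum (𝓞 ℚ), ((5 : ℕ) : 𝓞 ℚ) ∈ v.asIdeal →
      W.HasMultiplicativeReductionAt v) ∧
    (∀ v : HeightOneSpectrum (𝓞 ℚ), ((5 : ℕ) : 𝓞 ℚ) ∉ v.asIdeal →
      W.HasGoodReductionAt v ∨ W.HasMultiplicativeReductionAt v) :=
  ⟨fun v hv ↦ hasMultiplicativeReductionAt_of_atPrime W h5 v (by exact_mod_cast hv),
    fun v _ ↦ isSemistable_ringOfIntegers_of_isSemistable_int W hss v⟩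

/-- **E6c + S4b ⇒ E5 (PROVED)** — gen 5's corner engine, hence its case-B consumer
`isModularGaloisRepTate_five_of_corner`, is served by the place-level corner: `5 ∣ N_W` and
semistability give multiplicative reduction at the place above `5`
(`not_hasGoodReductionAt_ringOfIntegers_of_dvd_conductorNorm`), `25 ∤ N_W` (squarefree conductor)
feeds S4b. [folklore] -/
theorem liftFiveWilesCorner_of_localCorner (hC : LiftFiveLocalCorner) (h4b : AbsIrrSqrtFiveShape) :
    LiftFiveWilesCorner := by
  intro W W' _ _ _ ρ hss _ h5N _ hρ hρ' hirr hW'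
  have hssO : W.IsSemistable (𝓞 ℚ) := isSemistable_ringOfIntegers_of_isSemistable_int W hss
  have h25 : ¬ 25 ∣ W.conductorNorm ℤ := by
    intro h
    have hsq : Squarefree (W.conductorNorm ℤ) := (isSemistable_iff_squarefree_conductorNorm W).mp hss
    have hu : IsUnit 5 := hsq 5 (by norm_num at h ⊢; exact h)
    exact absurd (Nat.isUnit_iff.mp hu) (by norm_num)
  refine hC W W' ρ hρ hρ' (h4b W h25 ρ hρ hirr) hW' ?_ (fun v _ ↦ hssO v)
  intro v hv
  have hveq : v = (primesEquiv (R := 𝓞 ℚ)).symm ⟨5, Nat.prime_five⟩ :=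
    (natCast_mem_asIdeal_iff_eq_primesEquiv_symm v Nat.prime_five).mp hv
  have hbad : ¬ W.HasGoodReductionAt v := by
    rw [hveq]
    exact W.not_hasGoodReductionAt_ringOfIntegers_of_dvd_conductorNorm ⟨5, Nat.prime_five⟩ h5N
  exact (hssO v).resolve_left hbad

/-! ## §3 The typed gap in the tree's `T_Σ` (documentation-only Prop) -/

/-- **The ordinary-members gap.**  The tree's `modularLiftsOfTypeSigma p k Ō ρ Σ` admits only newform
members of level `M` with `¬ p ∣ M` (flat at `p`, DFG's setting); the pinned instance has `5 ∥ N_W`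
ALWAYS (gen 4), so an `R = T` port serving E6 must admit members of level `M` with `p ∥ M` that are
ordinary of weight `2` at `p` (`U_p`-eigenvalue a unit; fixed `det = χ₅` forces trivial nebentypus at
`5`, inertial exponent `1`) — DDT's `N_Σ` for `p ∈ Σ` with the Selmer/ordinary condition.  The Prop
records the membership condition such an extension needs (no object is built here).
[cite: DarmonDiamondTaylor1995, §2.7 and §3.3] -/
def OrdinaryMembersAllowed (N : Set (FramedGaloisRep ℚ (PadicAlgCl 5) 2)) : Prop :=
  ∀ ρ' ∈ N, ∀ v : HeightOneSpectrum (𝓞 ℚ), ((5 : ℕ) : 𝓞 ℚ) ∈ v.asIdeal →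
    FramedGaloisRep.IsOrdinaryOfWeightAt 5 ρ' v 2 1

/-- Sanity: the tree's flat `N_Σ` excludes level `M` with `p ∣ M` by definition (the clause `¬ p ∣ M`
of `mem_modularLiftsOfTypeSigma_iff`), so no member can be the `5`-adic representation attached to a
newform of level `N_W` with `5 ∣ N_W` AT THAT LEVEL. (Statement-level remark; the tree's membership
is existential in `M`, so we only record the shape.) [folklore] -/
example (p : ℕ) (k : ℤ) (Ō : Type) [CommRing Ō] [IsLocalRing Ō] [TopologicalSpace Ō]
    [Algebra ℤ_[5] Ō] (ρ : FramedGaloisRep ℚ ℤ_[5] 2) (S : Set ℕ) (ρ' : FramedGaloisRep ℚ Ō 2)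
    (h : ρ' ∈ modularLiftsOfTypeSigma p k Ō ρ S) :
    ∃ (M : ℕ), ¬ p ∣ M :=
  let ⟨⟨M, _, _, _, _, hpM, _⟩, _⟩ := (mem_modularLiftsOfTypeSigma_iff).mp h
  ⟨M, hpM⟩

end Summit.ABC.ABC.Cruxes.FreyModularity.StubIdeas.LiftFive3g6

end
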